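import Summits.ResolutionOfSingularities.ResolutionOfSingularities.Theorems.HilbertSamuelEliminationSigmaMaxModificationsCorridor3WLadderHybridLowSwallow
import HarnessLib

/-!
# [OURS · L1 W4.2] `Corridor3WLadderHybridLowPlug` — the Low adapter IN E7's GLOBAL-ROW SHAPE: from (b)/(c-swallow)/units rows stated AT `Q`-ORIGINS
# (origin-independent boundary `E₀' = fun X _ => E₀ X`) to `∀ e ≤ 2, MaxOriginNoMovingNearChainAtQσE σ p 3 Q E₀' (ē = e)` — the `hlow` input of
# res-D-pv-047's `rowsAtσE_of_globalRows` (E7, p532289); hybrid form with (c-rep)/(c-menu)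

Crux chain w42 (`SigmaMaxModifications`, stmt-ResolutionOfSingularities-18506; conjunct `SigmaMaxModificationsCorridor3`,
stmt-ResolutionOfSingularities-19249), res-L1-w42-plan-1 RULINGS v3.14-21 (FS) / v3.14-22 (FW). Typer res-type-040 (gen 19). Sequel of
`…WLadderHybridLow` (p534481: `low_init_of_births_swallow_units`) and `…WLadderHybridLowSwallow` (p535770: `low_init_hybrid_of_rows`); target shape =
E7's `rowsAtσE_of_globalRows … (hlow : ∀ e, e ≤ 2 → MaxOriginNoMovingNearChainAtQσE σ p 3 Q (fun X _ => E₀ X) fun s => s.geomDirDim = e) …`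
(`…SigmaHybridEliminationHyp` §5). OURS (cell res-hironaka, slot W4.2); NOT statements of H. Hironaka's manuscript [Hironaka2017] nor of
[CossartJannsenSaito2020]; AI-drafted, weaker than expert review. Sorry-free PROOF file: no definition, no named fact; the row hypotheses are the
From-`init` rows of `…HybridLowDefs` / `…HybridLowSwallow` quantified over `Q`-maximal origins (written inline), the units half is res-type-012's
`MaxOriginNoMovingRecurrentNearChainAtQσE` (p528217). Helper file `--supports stmt-ResolutionOfSingularities-19249` (counted 0).

Contents (namespace `…Theorems.SigmaMaxModificationsCorridor3.Sigma`): `maxOriginNoMovingNearChainAtQσE_low_of_births_swallow_units` (any functional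
σ admissible on its run-wise scope at every value `ν`), `maxOriginNoMovingNearChainAtQσE_low_hybrid_of_rows` (σ = `π.hybrid (ofStageOracleE ω)`
from (b), (c-rep), (c-menu), units). References: CJS LNM 2270 Rem. 6.29 (1), Thm. 6.35, Thm. 6.40, p. 107 [CossartJannsenSaito2020]; tree p532289,
p534481, p535770, p528217.
-/

noncomputable section

set_option linter.dupNamespace false

open CategoryTheory AlgebraicGeometry TopologicalSpace Topology
open Summit.ResolutionOfSingularities.ResolutionOfSingularities.Theorems.CampaignW42
open Literature.AlgebraicGeometry.Resolution Literature.RingTheory.HilbertSamuel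
open Literature.AlgebraicGeometry.CossartJannsenSaito2020
open Summit.ResolutionOfSingularities.ResolutionOfSingularities.Theorems.SigmaMaxModificationsCorridor3
open Summit.ResolutionOfSingularities.ResolutionOfSingularities.Theorems.SigmaMaxModificationsCorridor3.Moving

namespace Summit.ResolutionOfSingularities.ResolutionOfSingularities.Theorems.SigmaMaxModificationsCorridor3.Sigma

universe u

variable {p : ℕ} {Q : ℕ → (ℕ → ℕ) → ∀ X : Scheme.{u}, X → Prop} {E₀ : ∀ X : Scheme.{u}, Boundary X}

/-- **E7's `hlow` FROM ROWS AT `Q`-ORIGINS — any functional `σ` admissible on its run-wise scope (at every value `ν`):** (b)From, (c-swallow)From in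
the W-low grade `ē < 3` and the units half at every `Q`-maximal origin give `∀ e ≤ 2, MaxOriginNoMovingNearChainAtQσE σ p 3 Q (fun X _ => E₀ X) (ē = e)`,
modulo the kill row. [cite: CossartJannsenSaito2020, Thm. 6.35, Thm. 6.40, p. 107] -/
theorem maxOriginNoMovingNearChainAtQσE_low_of_births_swallow_units {σ : StrategyE.{u}} (hK : LocalNearPointChainsTerminate.{u})
    (hσ : ∀ ν, σ.IsFunctional 3 ν)
    (hadm : ∀ ν, IsAdmissibleStrategyOnE (StrategyE.RunReachableState p σ 3 ν fun X _ => E₀ X) 3 ν σ)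
    (hbirths : ∀ (ν : ℕ → ℕ) (X : Scheme.{u}) [IsLocallyNoetherian X] (x : X), IsMaximalOrigin p 3 ν X x → Q 3 ν X x →
      StrataBirthsSettleFromσE σ 3 ν (MarkedStageE.init X x (E₀ X)) fun s => s.geomDirDim < 3)
    (hswallow : ∀ (ν : ℕ → ℕ) (X : Scheme.{u}) [IsLocallyNoetherian X] (x : X), IsMaximalOrigin p 3 ν X x → Q 3 ν X x →
      StrataSwallowFromσE σ 3 ν (MarkedStageE.init X x (E₀ X)) fun s => s.geomDirDim < 3)
    (hunits : MaxOriginNoMovingRecurrentNearChainAtQσE σ p 3 Q (fun X _ => E₀ X) (fun s => s.geomDirDim < 3) fun s => Iso 3 s) :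
    ∀ e, e ≤ 2 → MaxOriginNoMovingNearChainAtQσE σ p 3 Q (fun X _ => E₀ X) fun s => s.geomDirDim = e := by
  intro e he ν X _ x hX hQ
  exact low_init_of_births_swallow_units (E₀ := fun X _ => E₀ X) hK (by norm_num) le_rfl (hσ ν) (hadm ν) hX
    (hbirths ν X x hX hQ) (hswallow ν X x hX hQ) (hunits ν X x hX hQ) e (by omega)

/-- **E7's `hlow` FOR THE MENU HYBRID `π.hybrid (ofStageOracleE ω)` FROM ITS FOUR NAMED ROWS AT `Q`-ORIGINS** — (b) births settle, (c-rep) no late replay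
through the chain point, (c-menu) late policy steps through the chain point swallow a stratum component, and the units half; π, ω functional; the hybrid
admissible on its run-wise scope at every `ν` (E7/E8 from `isAdmissibleStrategyOnE_hybrid_plus` / the widened menus). Modulo the kill row.
[cite: CossartJannsenSaito2020, Rem. 6.29 (1), Thm. 6.35, Thm. 6.40, p. 107] -/
theorem maxOriginNoMovingNearChainAtQσE_low_hybrid_of_rows {π : StrategyE.{u}} {ω : StageOracleE.{u}}
    (hK : LocalNearPointChainsTerminate.{u}) (hπ : ∀ ν, π.IsFunctional 3 ν) (hω : OracleFunctionalΩE ω)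
    (hadm : ∀ ν, IsAdmissibleStrategyOnE
      (StrategyE.RunReachableState p (π.hybrid (StrategyE.ofStageOracleE ω)) 3 ν fun X _ => E₀ X) 3 ν
      (π.hybrid (StrategyE.ofStageOracleE ω)))
    (hbirths : ∀ (ν : ℕ → ℕ) (X : Scheme.{u}) [IsLocallyNoetherian X] (x : X), IsMaximalOrigin p 3 ν X x → Q 3 ν X x →
      StrataBirthsSettleFromσE (π.hybrid (StrategyE.ofStageOracleE ω)) 3 ν (MarkedStageE.init X x (E₀ X)) fun s => s.geomDirDim < 3)
    (hrep : ∀ (ν : ℕ → ℕ) (X : Scheme.{u}) [IsLocallyNoetherian X] (x : X), IsMaximalOrigin p 3 ν X x → Q 3 ν X x →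
      StrataReplaySettleFromσE (π.hybrid (StrategyE.ofStageOracleE ω)) 3 ν (MarkedStageE.init X x (E₀ X)) fun s => s.geomDirDim < 3)
    (hmenu : ∀ (ν : ℕ → ℕ) (X : Scheme.{u}) [IsLocallyNoetherian X] (x : X), IsMaximalOrigin p 3 ν X x → Q 3 ν X x →
      StrataPolicySwallowFromσE π (π.hybrid (StrategyE.ofStageOracleE ω)) 3 ν (MarkedStageE.init X x (E₀ X))
        fun s => s.geomDirDim < 3)
    (hunits : MaxOriginNoMovingRecurrentNearChainAtQσE (π.hybrid (StrategyE.ofStageOracleE ω)) p 3 Q (fun X _ => E₀ X)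
      (fun s => s.geomDirDim < 3) fun s => Iso 3 s) :
    ∀ e, e ≤ 2 → MaxOriginNoMovingNearChainAtQσE (π.hybrid (StrategyE.ofStageOracleE ω)) p 3 Q (fun X _ => E₀ X)
      fun s => s.geomDirDim = e :=
  maxOriginNoMovingNearChainAtQσE_low_of_births_swallow_units hK
    (fun ν => (hπ ν).hybrid (StrategyE.isFunctional_ofStageOracleE hω 3 ν)) hadm hbirths
    (fun ν X _ x hX hQ => strataSwallowFromσE_hybrid_of_replaySettle_menuSwallow (hπ ν) hω (hrep ν X x hX hQ) (hmenu ν X x hX hQ))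
    hunits

end Summit.ResolutionOfSingularities.ResolutionOfSingularities.Theorems.SigmaMaxModificationsCorridor3.Sigma

end
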